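import Summits.AtomisticToContinuum.BoseEinsteinCondensation.Theorems.BECCutLineWeakDisorderLateCoreSplitZeroModeGroundState
import Summits.AtomisticToContinuum.BoseEinsteinCondensation.Theorems.BECCutLineWeakDisorderTwoReplicaTransienceBoundGroundStateLimit
import HarnessLib

/-!
# Route `BECCutLineWeakDisorder`, crux `TwoReplicaTransienceBound` (stmt-AtomisticToContinuum-9687),
# line `late-core-split`: the late-time triple `Late / Z / A` on bounded potentials IS a triple of
# ground-state statements — the polymer length leaves the picture

Support file (`--supports stmt-AtomisticToContinuum-9687`; registered toolbox stubs
`stub_lateBdd_iff_groundState`, `stub_noIntermittencyBdd_iff_groundState`; lead c7, cycle 3).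
Companion of `…LateCoreSplitZeroModeGroundState.lean` (which does `Z`).

For a BOUNDED admissible potential every box `Λ_L^{n+1}` carries its Feynman–Kac ground state `Ψ₀`
(`GroundStateFeynmanKac_holds`; unique, `IsGroundStateFK.unique`; positive on the open box), the
heat-flow witnesses converge to it pointwise and boundedly, and so along `T → ∞`, per box,
`I(T) → I(Ψ₀) := ∫ L³ m_{Ψ₀}²/s_{Ψ₀}²` (`GroundStateLimit.tendsto_lintegral_ratio_fkWitness_one`) and
`S(T) → S(Ψ₀) := ∫ s_{Ψ₀}²` (`tendsto_sliceMassSq_fkWitness_one`), with `0 < S(Ψ₀) ≤ L³` and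
`L³ ≤ I(Ψ₀)·S(Ψ₀)` (`groundState_data`). Consequently, restricted to bounded potentials and with the
constants shown, each `∀ᶠ T` statement of the line is EQUIVALENT to the corresponding statement about
the ground states, uniformly in the particle number at fixed small density:

* `stub_lateBdd_iff_groundState`: `LateTwoReplicaBound|bdd ⟺` the GROUND-STATE TWO-REPLICA BOUND
  `I(Ψ₀) ≤ C` for all large `n` (`⇒` as in `GroundStateLimit.twoReplicaTransienceBound_groundState`,
  here from the late bound only; `⇐` with `C + 1`);
* `stub_noIntermittencyBdd_iff_groundState`: `OverlapNoIntermittency|bdd ⟺` the ground-state `A₂`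
  condition `I(Ψ₀)·S(Ψ₀) ≤ C₂ L³` for all large `n` (`⇐` with `2C₂`);
* (`…ZeroModeGroundState.lean`) `WitnessZeroMode|bdd ⟺` flat-mode ODLRO `S(Ψ₀) ≥ c L³`;
* `groundStateBound_iff_zeroMode_noIntermittency`: at the ground state the split is again lossless,
  `(I(Ψ₀) ≤ C  ∀ᶠ n) ⟺ (S(Ψ₀) ≥ cL³  ∀ᶠ n) ∧ (I(Ψ₀)S(Ψ₀) ≤ C₂L³  ∀ᶠ n)`.

Reading for the planners: on bounded potentials the two late-time inputs `Z`, `A` of the route's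
hinge (`landscapeBound_of_zeroMode_noIntermittency`) are PROPERTIES OF THE DIRICHLET GROUND STATE
ALONE, uniform in `N` — flat-mode condensation of `Ψ₀` and no-intermittency of its slice
participation ratio; the polymer length `T` has left the critical path entirely.

## References

* B. Simon, *Schrödinger semigroups*, Bull. AMS 7 (1982), §A1 (A7). [Simon1982]
* E. H. Lieb, R. Seiringer, J. P. Solovej, J. Yngvason, *The Mathematics of the Bose Gas and its
  Condensation* (2005), §1.2 (1.19), Ch. 5. [LSSY2005]
-/

noncomputable section

open MeasureTheory Filter Set
open scoped ENNReal NNReal Topology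

namespace Summit.AtomisticToContinuum.BoseEinsteinCondensation.Cruxes.TwoReplicaTransienceBound.LateCoreSplit

open Literature.MathematicalPhysics.QuantumManyBody.BoseGas
open Summit.AtomisticToContinuum.BoseEinsteinCondensation.Theorems.CutLineWitness
open Summit.AtomisticToContinuum.BoseEinsteinCondensation.Theses.BECCutLineWeakDisorder
open Summit.AtomisticToContinuum.BoseEinsteinCondensation.Cruxes.TwoReplicaTransienceBound.GroundStateLimit

variable {n : ℕ}

/-! ### Ground-state data in a fixed box (bounded potential) -/

/-- `∫ |Ψ₀|² = 1` in the `‖·‖₊` form for a Feynman–Kac ground state (`Ψ₀ ≥ 0`). [folklore] -/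
theorem lintegral_nnnorm_sq_groundState {v : ℝ → ℝ≥0∞} {L : ℝ} {Ψ₀ : Config (n + 1) → ℝ}
    (h : IsGroundStateFK v L Ψ₀) : ∫⁻ X, (‖Ψ₀ X‖₊ : ℝ≥0∞) ^ 2 = 1 := by
  rw [← h.norm_eq]
  refine lintegral_congr fun X => ?_
  rw [← enorm_eq_nnnorm, Real.enorm_of_nonneg (h.nonneg X)]

/-- A Feynman–Kac ground state for a bounded potential is bounded: `|Ψ₀| ≤ K` (pointwise limit of
the uniformly bounded witnesses, `CutLineWitness.fkWitness_one_le`, `tendsto_fkWitness_one`).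
[cite: Simon1982, §A1 (A7) p. 449] -/
theorem exists_abs_groundState_le {v : ℝ → ℝ≥0∞} (hv : Measurable v) {C : ℝ≥0}
    (hC : ∀ r, v r ≤ C) {L : ℝ} (hL : 0 < L) {Ψ₀ : Config (n + 1) → ℝ}
    (h : IsGroundStateFK v L Ψ₀) : ∃ K : ℝ, ∀ X, |Ψ₀ X| ≤ K := by
  obtain ⟨K, hK⟩ := fkWitness_one_le hv hC hL h
  refine ⟨K, fun X => le_of_tendsto (tendsto_fkWitness_one hv hC hL h X).abs ?_⟩
  filter_upwards [eventually_ge_atTop (1 : ℝ)] with T hT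
  rw [abs_of_nonneg (fkWitness_nonneg v L T _ X)]
  exact hK T hT X

/-- **Ground-state data**: for a bounded admissible potential and the Feynman–Kac ground state `Ψ₀`
of `n+1` bosons in `Λ_L`, `S(Ψ₀) ≤ L³` (Cauchy–Schwarz within slices, `sliceSq_le_ofReal_volume`),
`L³ ≤ I(Ψ₀)·S(Ψ₀)` (Cauchy–Schwarz across slices, `ofReal_volume_le_ratio_mul_sliceSq`), hence
`S(Ψ₀) ≠ 0, ⊤`. [folklore] -/
theorem groundState_data {v : ℝ → ℝ≥0∞} (hv : Measurable v) {C : ℝ≥0} (hC : ∀ r, v r ≤ C)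
    {L : ℝ} (hL : 0 < L) {Ψ₀ : Config (n + 1) → ℝ} (h : IsGroundStateFK v L Ψ₀) :
    (∫⁻ Y : Config n, (∫⁻ x, (‖Ψ₀ (Matrix.vecCons x Y)‖₊ : ℝ≥0∞)) ^ 2) ≤ ENNReal.ofReal (L ^ 3) ∧
    ENNReal.ofReal (L ^ 3) ≤
      (∫⁻ Y : Config n, ENNReal.ofReal (L ^ 3) *
        (∫⁻ x, (‖Ψ₀ (Matrix.vecCons x Y)‖₊ : ℝ≥0∞) ^ 2) ^ 2 /
          (∫⁻ x, (‖Ψ₀ (Matrix.vecCons x Y)‖₊ : ℝ≥0∞)) ^ 2) *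
      ∫⁻ Y : Config n, (∫⁻ x, (‖Ψ₀ (Matrix.vecCons x Y)‖₊ : ℝ≥0∞)) ^ 2 ∧
    (∫⁻ Y : Config n, (∫⁻ x, (‖Ψ₀ (Matrix.vecCons x Y)‖₊ : ℝ≥0∞)) ^ 2) ≠ 0 ∧
    (∫⁻ Y : Config n, (∫⁻ x, (‖Ψ₀ (Matrix.vecCons x Y)‖₊ : ℝ≥0∞)) ^ 2) ≠ ⊤ := by
  obtain ⟨K, hK⟩ := exists_abs_groundState_le hv hC hL h
  have hnorm := lintegral_nnnorm_sq_groundState h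
  have hS := sliceSq_le_ofReal_volume hL h.measurable h.eq_zero hnorm
  have hIS := ofReal_volume_le_ratio_mul_sliceSq hL h.measurable h.eq_zero hK hnorm
  have hV0 : ENNReal.ofReal (L ^ 3) ≠ 0 := (ENNReal.ofReal_pos.2 (by positivity)).ne'
  refine ⟨hS, hIS, fun h0 => hV0 ?_, ne_top_of_le_ne_top ENNReal.ofReal_ne_top hS⟩
  rw [h0, mul_zero] at hIS
  exact le_antisymm hIS bot_le

/-- In the box of side `((n+1)/ρ)^{1/3}` with a bounded admissible potential, a Feynman–Kac ground
state is THE positive one of `GroundStateFeynmanKac_holds` (uniqueness), so the crux functional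
converges to its ground-state value along the witnesses:
`overlap v ρ n T → I(Ψ₀)` and `sliceMassSq v ρ n T → S(Ψ₀)`. [cite: Simon1982, §A1 (A7) p. 449] -/
theorem tendsto_overlap_sliceMassSq {v : ℝ → ℝ≥0∞} (hv : IsRepulsiveFiniteRange v) {Cv : ℝ≥0}
    (hCv : ∀ r, v r ≤ Cv) {ρ : ℝ} (hρ : 0 < ρ) (n : ℕ) {Ψ₀ : Config (n + 1) → ℝ}
    (h : IsGroundStateFK v (sideLength ρ (n + 1)) Ψ₀) :
    Tendsto (fun T : ℝ => overlap v ρ n T) atTop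
      (𝓝 (∫⁻ Y : Config n, ENNReal.ofReal (sideLength ρ (n + 1) ^ 3) *
        (∫⁻ x, (‖Ψ₀ (Matrix.vecCons x Y)‖₊ : ℝ≥0∞) ^ 2) ^ 2 /
          (∫⁻ x, (‖Ψ₀ (Matrix.vecCons x Y)‖₊ : ℝ≥0∞)) ^ 2)) ∧
    Tendsto (fun T : ℝ => sliceMassSq v ρ n T) atTop
      (𝓝 (∫⁻ Y : Config n, (∫⁻ x, (‖Ψ₀ (Matrix.vecCons x Y)‖₊ : ℝ≥0∞)) ^ 2)) := by
  have hL : 0 < sideLength ρ (n + 1) :=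
      Real.rpow_pos_of_pos (div_pos (Nat.cast_pos.mpr n.succ_pos) hρ) _
  obtain ⟨Φ, hΦ, -, hΦpos⟩ := GroundStateFeynmanKac_holds (n + 1) (sideLength ρ (n + 1)) v
    (Nat.le_add_left 1 n) hL hv.1 ⟨Cv, hCv⟩
  have hEq : Ψ₀ = Φ := h.unique hΦ
  subst hEq
  exact ⟨tendsto_lintegral_ratio_fkWitness_one hv.1 hCv hL h hΦpos,
    tendsto_sliceMassSq_fkWitness_one hv.1 hCv hL h⟩

/-! ### `Late|bdd ⟺` the ground-state two-replica bound -/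

/-- **Registered toolbox stub `stub_lateBdd_iff_groundState`.** On bounded admissible potentials the
late-time two-replica bound (`overlap ≤ C` eventually in `T`, all large `n`) is EQUIVALENT to the
ground-state two-replica bound `∫ L³ m_{Ψ₀}²/s_{Ψ₀}² ≤ C'` for all large `n` (`⇒`: `T → ∞` per box,
`le_of_tendsto`, `C' = C`; `⇐`: `I(T) → I(Ψ₀) ≤ C < C + 1`, so `I(T) < C + 1` eventually).
[cite: Simon1982, §A1 (A7) p. 449] -/
theorem stub_lateBdd_iff_groundState :
    (∀ v : ℝ → ℝ≥0∞, IsRepulsiveFiniteRange v → (∃ C : ℝ≥0, ∀ r, v r ≤ C) →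
      ∃ ρ₀ : ℝ, 0 < ρ₀ ∧ ∀ ρ : ℝ, 0 < ρ → ρ < ρ₀ → ∃ C : ℝ, 0 < C ∧ ∀ᶠ n : ℕ in atTop,
        ∀ᶠ T : ℝ in atTop, overlap v ρ n T ≤ ENNReal.ofReal C) ↔
    (∀ v : ℝ → ℝ≥0∞, IsRepulsiveFiniteRange v → (∃ C : ℝ≥0, ∀ r, v r ≤ C) →
      ∃ ρ₀ : ℝ, 0 < ρ₀ ∧ ∀ ρ : ℝ, 0 < ρ → ρ < ρ₀ → ∃ C : ℝ, 0 < C ∧ ∀ᶠ n : ℕ in atTop,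
        ∀ Ψ₀ : Config (n + 1) → ℝ, IsGroundStateFK v (sideLength ρ (n + 1)) Ψ₀ →
          ∫⁻ Y : Config n, ENNReal.ofReal (sideLength ρ (n + 1) ^ 3) *
              (∫⁻ x, (‖Ψ₀ (Matrix.vecCons x Y)‖₊ : ℝ≥0∞) ^ 2) ^ 2 /
              (∫⁻ x, (‖Ψ₀ (Matrix.vecCons x Y)‖₊ : ℝ≥0∞)) ^ 2 ≤ ENNReal.ofReal C) := by
  constructor
  · intro hLate v hv hb
    obtain ⟨Cv, hCv⟩ := hb
    obtain ⟨ρ₀, hρ₀, H⟩ := hLate v hv ⟨Cv, hCv⟩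
    refine ⟨ρ₀, hρ₀, fun ρ hρ hρlt => ?_⟩
    obtain ⟨C, hC, hev⟩ := H ρ hρ hρlt
    refine ⟨C, hC, ?_⟩
    filter_upwards [hev] with n hn Ψ₀ hΨ₀
    exact le_of_tendsto (tendsto_overlap_sliceMassSq hv hCv hρ n hΨ₀).1 hn
  · intro hGS v hv hb
    obtain ⟨Cv, hCv⟩ := hb
    obtain ⟨ρ₀, hρ₀, H⟩ := hGS v hv ⟨Cv, hCv⟩
    refine ⟨ρ₀, hρ₀, fun ρ hρ hρlt => ?_⟩
    obtain ⟨C, hC, hev⟩ := H ρ hρ hρlt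
    refine ⟨C + 1, by positivity, ?_⟩
    filter_upwards [hev] with n hn
    have hL : 0 < sideLength ρ (n + 1) :=
      Real.rpow_pos_of_pos (div_pos (Nat.cast_pos.mpr n.succ_pos) hρ) _
    obtain ⟨Φ, hΦ, -, -⟩ := GroundStateFeynmanKac_holds (n + 1) (sideLength ρ (n + 1)) v
      (Nat.le_add_left 1 n) hL hv.1 ⟨Cv, hCv⟩
    have hlt : ∫⁻ Y : Config n, ENNReal.ofReal (sideLength ρ (n + 1) ^ 3) *
        (∫⁻ x, (‖Φ (Matrix.vecCons x Y)‖₊ : ℝ≥0∞) ^ 2) ^ 2 /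
          (∫⁻ x, (‖Φ (Matrix.vecCons x Y)‖₊ : ℝ≥0∞)) ^ 2 < ENNReal.ofReal (C + 1) :=
      (hn Φ hΦ).trans_lt ((ENNReal.ofReal_lt_ofReal_iff (by positivity)).2 (lt_add_one C))
    filter_upwards [(tendsto_overlap_sliceMassSq hv hCv hρ n hΦ).1.eventually_lt_const hlt]
      with T hT using hT.le

/-! ### `A|bdd ⟺` the ground-state `A₂` condition -/

/-- **Registered toolbox stub `stub_noIntermittencyBdd_iff_groundState`.** On bounded admissible
potentials the late-time no-intermittency condition (`overlap · sliceMassSq ≤ C₂ L³` eventually in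
`T`, all large `n`) is EQUIVALENT to the ground-state `A₂` condition `I(Ψ₀)·S(Ψ₀) ≤ C₂' L³` for all
large `n` (`⇒`: the product converges since `0 < S(Ψ₀) < ∞`, `ENNReal.Tendsto.mul`, `C₂' = C₂`;
`⇐` with `2C₂`). [cite: Simon1982, §A1 (A7) p. 449] -/
theorem stub_noIntermittencyBdd_iff_groundState :
    (∀ v : ℝ → ℝ≥0∞, IsRepulsiveFiniteRange v → (∃ C : ℝ≥0, ∀ r, v r ≤ C) →
      ∃ ρ₀ : ℝ, 0 < ρ₀ ∧ ∀ ρ : ℝ, 0 < ρ → ρ < ρ₀ → ∃ C₂ : ℝ, 0 < C₂ ∧ ∀ᶠ n : ℕ in atTop,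
        ∀ᶠ T : ℝ in atTop, overlap v ρ n T * sliceMassSq v ρ n T ≤
          ENNReal.ofReal C₂ * ENNReal.ofReal (sideLength ρ (n + 1) ^ 3)) ↔
    (∀ v : ℝ → ℝ≥0∞, IsRepulsiveFiniteRange v → (∃ C : ℝ≥0, ∀ r, v r ≤ C) →
      ∃ ρ₀ : ℝ, 0 < ρ₀ ∧ ∀ ρ : ℝ, 0 < ρ → ρ < ρ₀ → ∃ C₂ : ℝ, 0 < C₂ ∧ ∀ᶠ n : ℕ in atTop,
        ∀ Ψ₀ : Config (n + 1) → ℝ, IsGroundStateFK v (sideLength ρ (n + 1)) Ψ₀ →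
          (∫⁻ Y : Config n, ENNReal.ofReal (sideLength ρ (n + 1) ^ 3) *
              (∫⁻ x, (‖Ψ₀ (Matrix.vecCons x Y)‖₊ : ℝ≥0∞) ^ 2) ^ 2 /
              (∫⁻ x, (‖Ψ₀ (Matrix.vecCons x Y)‖₊ : ℝ≥0∞)) ^ 2) *
            (∫⁻ Y : Config n, (∫⁻ x, (‖Ψ₀ (Matrix.vecCons x Y)‖₊ : ℝ≥0∞)) ^ 2) ≤
          ENNReal.ofReal C₂ * ENNReal.ofReal (sideLength ρ (n + 1) ^ 3)) := by
  constructor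
  · intro hA v hv hb
    obtain ⟨Cv, hCv⟩ := hb
    obtain ⟨ρ₀, hρ₀, H⟩ := hA v hv ⟨Cv, hCv⟩
    refine ⟨ρ₀, hρ₀, fun ρ hρ hρlt => ?_⟩
    obtain ⟨C₂, hC₂, hev⟩ := H ρ hρ hρlt
    refine ⟨C₂, hC₂, ?_⟩
    filter_upwards [hev] with n hn Ψ₀ hΨ₀
    obtain ⟨hI, hS⟩ := tendsto_overlap_sliceMassSq hv hCv hρ n hΨ₀
    obtain ⟨-, -, hS0, hStop⟩ := groundState_data hv.1 hCv (show 0 < sideLength ρ (n + 1) from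
      Real.rpow_pos_of_pos (div_pos (Nat.cast_pos.mpr n.succ_pos) hρ) _) hΨ₀
    exact le_of_tendsto (ENNReal.Tendsto.mul hI (Or.inr hStop) hS (Or.inl hS0)) hn
  · intro hGS v hv hb
    obtain ⟨Cv, hCv⟩ := hb
    obtain ⟨ρ₀, hρ₀, H⟩ := hGS v hv ⟨Cv, hCv⟩
    refine ⟨ρ₀, hρ₀, fun ρ hρ hρlt => ?_⟩
    obtain ⟨C₂, hC₂, hev⟩ := H ρ hρ hρlt
    refine ⟨2 * C₂, by positivity, ?_⟩
    filter_upwards [hev] with n hn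
    have hL : 0 < sideLength ρ (n + 1) :=
      Real.rpow_pos_of_pos (div_pos (Nat.cast_pos.mpr n.succ_pos) hρ) _
    have hL3 : 0 < sideLength ρ (n + 1) ^ 3 := pow_pos hL 3
    obtain ⟨Φ, hΦ, -, -⟩ := GroundStateFeynmanKac_holds (n + 1) (sideLength ρ (n + 1)) v
      (Nat.le_add_left 1 n) hL hv.1 ⟨Cv, hCv⟩
    obtain ⟨hI, hS⟩ := tendsto_overlap_sliceMassSq hv hCv hρ n hΦ
    obtain ⟨-, -, hS0, hStop⟩ := groundState_data hv.1 hCv hL hΦ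
    have hlt : (∫⁻ Y : Config n, ENNReal.ofReal (sideLength ρ (n + 1) ^ 3) *
        (∫⁻ x, (‖Φ (Matrix.vecCons x Y)‖₊ : ℝ≥0∞) ^ 2) ^ 2 /
          (∫⁻ x, (‖Φ (Matrix.vecCons x Y)‖₊ : ℝ≥0∞)) ^ 2) *
        (∫⁻ Y : Config n, (∫⁻ x, (‖Φ (Matrix.vecCons x Y)‖₊ : ℝ≥0∞)) ^ 2) <
        ENNReal.ofReal (2 * C₂) * ENNReal.ofReal (sideLength ρ (n + 1) ^ 3) := by
      refine (hn Φ hΦ).trans_lt ?_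
      rw [← ENNReal.ofReal_mul hC₂.le, ← ENNReal.ofReal_mul (by positivity),
        ENNReal.ofReal_lt_ofReal_iff (by positivity)]
      nlinarith
    filter_upwards [(ENNReal.Tendsto.mul hI (Or.inr hStop) hS (Or.inl hS0)).eventually_lt_const hlt]
      with T hT using hT.le

/-! ### At the ground state the split is lossless too -/

/-- **Ground-state split**: for bounded admissible potentials, the ground-state two-replica bound
(`I(Ψ₀) ≤ C` for all large `n`) is EQUIVALENT to flat-mode ODLRO of the ground state
(`S(Ψ₀) ≥ c L³`) together with the ground-state `A₂` condition (`I(Ψ₀)S(Ψ₀) ≤ C₂ L³`):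
`⇒` by `L³ ≤ I·S ≤ C·S` (`c = 1/C`) and `S ≤ L³` (`C₂ = C`); `⇐` by `c L³ ≤ S`, `I·S ≤ C₂ L³`
(`overlap_le_of_zeroMode_noIntermittency`, `C = C₂/c`). [folklore] -/
theorem groundStateBound_iff_zeroMode_noIntermittency :
    (∀ v : ℝ → ℝ≥0∞, IsRepulsiveFiniteRange v → (∃ C : ℝ≥0, ∀ r, v r ≤ C) →
      ∃ ρ₀ : ℝ, 0 < ρ₀ ∧ ∀ ρ : ℝ, 0 < ρ → ρ < ρ₀ → ∃ C : ℝ, 0 < C ∧ ∀ᶠ n : ℕ in atTop,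
        ∀ Ψ₀ : Config (n + 1) → ℝ, IsGroundStateFK v (sideLength ρ (n + 1)) Ψ₀ →
          ∫⁻ Y : Config n, ENNReal.ofReal (sideLength ρ (n + 1) ^ 3) *
              (∫⁻ x, (‖Ψ₀ (Matrix.vecCons x Y)‖₊ : ℝ≥0∞) ^ 2) ^ 2 /
              (∫⁻ x, (‖Ψ₀ (Matrix.vecCons x Y)‖₊ : ℝ≥0∞)) ^ 2 ≤ ENNReal.ofReal C) ↔
    (∀ v : ℝ → ℝ≥0∞, IsRepulsiveFiniteRange v → (∃ C : ℝ≥0, ∀ r, v r ≤ C) →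
      ∃ ρ₀ : ℝ, 0 < ρ₀ ∧ ∀ ρ : ℝ, 0 < ρ → ρ < ρ₀ → ∃ c : ℝ, 0 < c ∧ ∀ᶠ n : ℕ in atTop,
        ∀ Ψ₀ : Config (n + 1) → ℝ, IsGroundStateFK v (sideLength ρ (n + 1)) Ψ₀ →
          ENNReal.ofReal (c * sideLength ρ (n + 1) ^ 3) ≤
            ∫⁻ Y : Config n, (∫⁻ x, (‖Ψ₀ (Matrix.vecCons x Y)‖₊ : ℝ≥0∞)) ^ 2) ∧
    (∀ v : ℝ → ℝ≥0∞, IsRepulsiveFiniteRange v → (∃ C : ℝ≥0, ∀ r, v r ≤ C) →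
      ∃ ρ₀ : ℝ, 0 < ρ₀ ∧ ∀ ρ : ℝ, 0 < ρ → ρ < ρ₀ → ∃ C₂ : ℝ, 0 < C₂ ∧ ∀ᶠ n : ℕ in atTop,
        ∀ Ψ₀ : Config (n + 1) → ℝ, IsGroundStateFK v (sideLength ρ (n + 1)) Ψ₀ →
          (∫⁻ Y : Config n, ENNReal.ofReal (sideLength ρ (n + 1) ^ 3) *
              (∫⁻ x, (‖Ψ₀ (Matrix.vecCons x Y)‖₊ : ℝ≥0∞) ^ 2) ^ 2 /
              (∫⁻ x, (‖Ψ₀ (Matrix.vecCons x Y)‖₊ : ℝ≥0∞)) ^ 2) *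
            (∫⁻ Y : Config n, (∫⁻ x, (‖Ψ₀ (Matrix.vecCons x Y)‖₊ : ℝ≥0∞)) ^ 2) ≤
          ENNReal.ofReal C₂ * ENNReal.ofReal (sideLength ρ (n + 1) ^ 3)) := by
  constructor
  · intro hGS
    constructor
    · intro v hv hb
      obtain ⟨Cv, hCv⟩ := hb
      obtain ⟨ρ₀, hρ₀, H⟩ := hGS v hv ⟨Cv, hCv⟩
      refine ⟨ρ₀, hρ₀, fun ρ hρ hρlt => ?_⟩
      obtain ⟨C, hC, hev⟩ := H ρ hρ hρlt
      refine ⟨1 / C, by positivity, ?_⟩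
      filter_upwards [hev] with n hn Ψ₀ hΨ₀
      have hL : 0 < sideLength ρ (n + 1) :=
      Real.rpow_pos_of_pos (div_pos (Nat.cast_pos.mpr n.succ_pos) hρ) _
      obtain ⟨-, hIS, -, -⟩ := groundState_data hv.1 hCv hL hΨ₀
      set V : ℝ≥0∞ := ENNReal.ofReal (sideLength ρ (n + 1) ^ 3) with hVdef
      have hle : V ≤ ENNReal.ofReal C *
          ∫⁻ Y : Config n, (∫⁻ x, (‖Ψ₀ (Matrix.vecCons x Y)‖₊ : ℝ≥0∞)) ^ 2 :=
        hIS.trans (mul_le_mul' (hn Ψ₀ hΨ₀) le_rfl)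
      have hC0 : ENNReal.ofReal C ≠ 0 := (ENNReal.ofReal_pos.2 hC).ne'
      calc ENNReal.ofReal (1 / C * sideLength ρ (n + 1) ^ 3)
          = V / ENNReal.ofReal C := by
            rw [hVdef, one_div, inv_mul_eq_div, ENNReal.ofReal_div_of_pos hC]
        _ ≤ ∫⁻ Y : Config n, (∫⁻ x, (‖Ψ₀ (Matrix.vecCons x Y)‖₊ : ℝ≥0∞)) ^ 2 := by
            rw [ENNReal.div_le_iff_le_mul (Or.inl hC0) (Or.inl ENNReal.ofReal_ne_top), mul_comm]
            exact hle
    · intro v hv hb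
      obtain ⟨Cv, hCv⟩ := hb
      obtain ⟨ρ₀, hρ₀, H⟩ := hGS v hv ⟨Cv, hCv⟩
      refine ⟨ρ₀, hρ₀, fun ρ hρ hρlt => ?_⟩
      obtain ⟨C, hC, hev⟩ := H ρ hρ hρlt
      refine ⟨C, hC, ?_⟩
      filter_upwards [hev] with n hn Ψ₀ hΨ₀
      obtain ⟨hS, -, -, -⟩ := groundState_data hv.1 hCv (show 0 < sideLength ρ (n + 1) from
      Real.rpow_pos_of_pos (div_pos (Nat.cast_pos.mpr n.succ_pos) hρ) _) hΨ₀
      exact mul_le_mul' (hn Ψ₀ hΨ₀) hS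
  · rintro ⟨hZ, hA⟩ v hv hb
    obtain ⟨Cv, hCv⟩ := hb
    obtain ⟨ρ₁, hρ₁, H1⟩ := hZ v hv ⟨Cv, hCv⟩
    obtain ⟨ρ₂, hρ₂, H2⟩ := hA v hv ⟨Cv, hCv⟩
    refine ⟨min ρ₁ ρ₂, lt_min hρ₁ hρ₂, fun ρ hρ hρlt => ?_⟩
    obtain ⟨c, hc, evZ⟩ := H1 ρ hρ (hρlt.trans_le (min_le_left _ _))
    obtain ⟨C₂, hC₂, evA⟩ := H2 ρ hρ (hρlt.trans_le (min_le_right _ _))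
    refine ⟨C₂ / c, div_pos hC₂ hc, ?_⟩
    filter_upwards [evZ, evA] with n hnZ hnA Ψ₀ hΨ₀
    exact overlap_le_of_zeroMode_noIntermittency hc (sideLength_cube_pos hρ n) hC₂.le (hnZ Ψ₀ hΨ₀)
      (hnA Ψ₀ hΨ₀)

end Summit.AtomisticToContinuum.BoseEinsteinCondensation.Cruxes.TwoReplicaTransienceBound.LateCoreSplit

end
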